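import Summits.BirchSwinnertonDyer.Rank1Residual.X2.EulerFactorAlgebra
import HarnessLib

/-!
# Class X2 / X1 (Eisenstein primes): Greenberg–Vatsal's Euler-factor elements `𝒫_ℓ(T) ∈ Λ` have
# `μ = 0` and `λ = s_ℓ d_ℓ = δ_E^{(ℓ)}` — §1 display (9) and the invariants of Prop. (2.4) IN THE KERNEL
# (cell `b2b-bsdres`, unit `b2b-bsdres-eisenstein-p2`, gen 17; part 2 of 2, see `EulerFactorAlgebra`)

HONEST FRAMING (run/shared/lean/b2b/bsd-rank1-residual/, verbatim in every file): the goal of the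
cell is to DELETE the COMBINATION-SHAPED residual classes of the Birch–Swinnerton-Dyer formula for
ALL analytic-rank `≤ 1` elliptic curves over `ℚ` — "full BSD formula for every rank `≤ 1` curve in
class `C`" assembled STRICTLY from published theorems — so that the rank-`≤ 1` remainder becomes
exactly the CONSTRUCTION-SHAPED classes, which are TYPED (missing-input `Prop`s), NOT attempted.
This is not "finishing BSD". Research route; NO CLAIM BEYOND STATED CLASSES; nothing here changes
a label. THEOREMS ONLY (no `def`, no named fact, no `sorry`).

WHY THIS FILE (X2-GAP §21.6 (ii), the successor programme for the X2a flag `GV00-mult-asserted`).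
The cell's named fact `GreenbergVatsal2000.lambda_muAnal_multiplicative_of_gvPar` (the exact content
of the flag) speaks about THE primitive multiplicative `p`-adic `L`-function `L = L(E/ℚ, T)`, while
every PRINTED analytic statement of Greenberg–Vatsal's proof (Thm. (3.11), (26)–(28)) is about the
NON-PRIMITIVE function `L_{Σ₀}(E/ℚ, T) = L(E/ℚ, T) · ∏_{ℓ∈Σ₀} 𝒫_ℓ(T)` (now a Literature definition,
`GreenbergVatsal2000/NonPrimitivePAdicLFunction.lean`). The passage between the two is GV's
display (9), `λ^{anal}_{E,Σ₀} = λ^{anal}_E + Σ_{ℓ∈Σ₀} δ_E^{(ℓ)}`, `μ^{anal}_{E,Σ₀} = μ^{anal}_E`, which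
rests on "`𝒫_ℓ(T)` is a nonzero element of `Λ` which is not divisible by `p`" (p. 9) and "Its
`μ`-invariant is zero. Its `λ`-invariant is equal to `s_ℓ d_ℓ`" (Prop. (2.4)). This file PROVES
these statements for the element `𝒫_ℓ(T) = P_ℓ(E/ℚ, ℓ⁻¹(1 + T)^{f_ℓ})` at every prime `ℓ ≠ p`,
`p` odd, with `s_ℓ d_ℓ = GreenbergVatsal2000.delta W p v` the SAME local invariant that the
algebraic side (`NonPrimitiveLambdaInvariant`, A115; `…Multiplicative`, A133) uses:

* (part 1, `X2/EulerFactorAlgebra.lean`: the `E`-free algebra — `ord_T P(a + ε) = mult_a(P)·ord_T ε`,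
  Frobenius `ord_T(H^{p^n} − 1) = p^n`, `ord_T((1+T)^f − 1 mod p) = p^{v_p(f)}`, and
  `p^{v_p(f_ℓ)} = s_ℓ` for the Frobenius exponent `f_ℓ`, `ℓ > 1` prime to the odd prime `p`.)
* §2 (`𝒫_ℓ`): `map_toZMod_eulerFactorElement` — `𝒫_ℓ mod p = P̃_ℓ(ℓ̃⁻¹ · ((1+T)^{f_ℓ} mod p))`;
  **`order_map_toZMod_eulerFactorElement`**: `ord_T(𝒫_ℓ mod p) = s_ℓ · d_ℓ = δ_E^{(ℓ)}`
  (`= delta W p v`); **`hasUnitContent_eulerFactorElement`**: `p ∤ 𝒫_ℓ` (`μ(𝒫_ℓ) = 0`);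
  `eulerFactorElement_ne_zero`.
* §3 (display (9)): `order_map_toZMod_eulerFactorProduct` — `ord_T(∏_{ℓ∈Σ₀} 𝒫_ℓ mod p) = Σ δ`;
  `hasUnitContent_mul_eulerFactorProduct_iff` (`μ^{anal}_{E,Σ₀} = μ^{anal}_E`) and
  `order_map_toZMod_mul_eulerFactorProduct` (`λ^{anal}_{E,Σ₀} = λ^{anal}_E + Σ_{ℓ∈Σ₀} δ_E^{(ℓ)}`) for
  any `b ∈ Λ` with `ι b = ϖ·L` (then `ι(b · ∏𝒫_ℓ) = ϖ · L_{Σ₀}`); and the EXACT TRANSFER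
  **`unitContent_and_order_eq_iff_nonPrimitive`**: the (iv)+(v) clause of
  `lambda_muAnal_multiplicative_of_gvPar` for `b` (unit content and `ord_T(b̄) = ord_T(ḡ)`) is
  EQUIVALENT to the same clause for `b^{Σ₀} = b · ∏𝒫_ℓ` with the target order shifted by
  `Σ_{ℓ∈Σ₀} δ_E^{(ℓ)}` — Greenberg–Vatsal's Thm. (1.5) (1)–(2), analytic half, as a kernel theorem at
  ANY `p`-adic `L`-function (good ordinary or multiplicative: the statement is about `Λ` only).

What this does NOT do: it does not touch the congruence `L_{Σ₀}(E/ℚ, T) ≡ u·L(G, T) (mod π)`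
(GV Thm. (3.11)) nor the character counts (26)–(28) / pp. 29–30 — those remain PRINTED inputs of
the flag (X2-GAP §21.1 (a)–(c)); after this file item (d) of that list is a kernel theorem.

References: [GreenbergVatsal2000] §1 pp. 8–9 (displays (8)–(9)), Thm. (1.5), §2 Prop. (2.4)
(p. 22); [Serre1973] Ch. II §3.2; [Washington1997] §7.1; HOME/b2b-bsdres-eisenstein-p2/X2-GAP.md §22.
-/

set_option autoImplicit false

noncomputable section

open scoped Classical

open Polynomial NumberField IsDedekindDomain WeierstrassCurve Literature.NumberTheory.EllipticCurves
  Literature.NumberTheory.EllipticCurves.GreenbergVatsal2000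
  Summit.BirchSwinnertonDyer.Rank1Residual.X2.EulerFactorAlgebra

namespace Summit.BirchSwinnertonDyer.Rank1Residual.X2.EulerFactorInvariants

/-! ## §2. `𝒫_ℓ mod p`, `λ(𝒫_ℓ) = s_ℓ d_ℓ = δ_E^{(ℓ)}`, `μ(𝒫_ℓ) = 0` -/

section EulerFactor

variable (W : WeierstrassCurve ℚ) {p : ℕ} [hp : Fact p.Prime] (v : HeightOneSpectrum (𝓞 ℚ))

/-- The Euler factor `P_ℓ(E/ℚ, X)` has constant term `1` (`1 − a X + ℓ X²`, `1 ∓ X`, `1`). -/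
theorem coeff_zero_localPolynomialAt : (W.localPolynomialAt v).coeff 0 = 1 := by
  unfold WeierstrassCurve.localPolynomialAt WeierstrassCurve.localPolynomial
  split_ifs <;> simp

/-- `P̃_ℓ(X) ∈ 𝔽_p[X]` has constant term `1`; in particular it is nonzero. -/
theorem coeff_zero_eulerFactorModP : (eulerFactorModP W p v).coeff 0 = 1 := by
  rw [eulerFactorModP, Polynomial.coeff_map, coeff_zero_localPolynomialAt, map_one]

/-- `P̃_ℓ ≠ 0`. -/
theorem eulerFactorModP_ne_zero : eulerFactorModP W p v ≠ 0 := by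
  intro h
  have := coeff_zero_eulerFactorModP W v (p := p)
  rw [h, Polynomial.coeff_zero] at this
  exact zero_ne_one this

/-- For `ℓ = natGenerator v ≠ p`: `ℓ` is prime to `p` and `> 1`. -/
theorem coprime_natGenerator (hℓ : Rat.HeightOneSpectrum.natGenerator v ≠ p) :
    p.Coprime (Rat.HeightOneSpectrum.natGenerator v) ∧ 1 < Rat.HeightOneSpectrum.natGenerator v :=
  ⟨(Nat.coprime_primes hp.out (Rat.HeightOneSpectrum.prime_natGenerator v)).mpr (Ne.symm hℓ),
    (Rat.HeightOneSpectrum.prime_natGenerator v).one_lt⟩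

omit hp in
/-- The cell's other spelling of "`v ∤ p`" (`(p : 𝓞 ℚ) ∉ v`, as in the gen-13/16 counts) implies
`natGenerator v ≠ p` (Mathlib `Rat.HeightOneSpectrum.natGenerator_dvd_iff`). -/
theorem natGenerator_ne_of_natCast_not_mem (h : ((p : ℕ) : 𝓞 ℚ) ∉ v.asIdeal) :
    Rat.HeightOneSpectrum.natGenerator v ≠ p := by
  intro hgen
  apply h
  have hdvd : Rat.HeightOneSpectrum.natGenerator v ∣ p := hgen ▸ dvd_refl _
  rw [Rat.HeightOneSpectrum.natGenerator_dvd_iff] at hdvd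
  obtain ⟨x, hx, hxe⟩ := (Ideal.mem_map_of_equiv _ _).mp hdvd
  have : x = (p : 𝓞 ℚ) := by
    apply (Rat.IsIntegralClosure.intEquiv (𝓞 ℚ)).injective
    rw [hxe, map_natCast]
  rwa [this] at hx

/-- Reduction of `ℓ⁻¹ ∈ ℤ_p` (`PadicInt.inv`) is `ℓ̃⁻¹ ∈ 𝔽_p` for `ℓ` prime to `p`. -/
theorem toZMod_inv_natCast {ℓ : ℕ} (hℓ : p.Coprime ℓ) :
    PadicInt.toZMod ((ℓ : ℤ_[p]).inv) = ((ℓ : ZMod p))⁻¹ := by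
  have hnorm : ‖(ℓ : ℤ_[p])‖ = 1 := PadicInt.norm_natCast_eq_one_iff.mpr hℓ
  have hmul : PadicInt.toZMod (p := p) (ℓ : ℤ_[p]) * PadicInt.toZMod ((ℓ : ℤ_[p]).inv) = 1 := by
    rw [← map_mul, PadicInt.mul_inv hnorm, map_one]
  rw [map_natCast] at hmul
  exact (eq_inv_of_mul_eq_one_right hmul)

/-- **`𝒫_ℓ mod p = P̃_ℓ(ℓ̃⁻¹ · ((1 + T)^{f_ℓ} mod p))`** in `𝔽_p⟦T⟧` (reduction is a ring map and
`P_ℓ` has integer coefficients). -/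
theorem map_toZMod_eulerFactorElement (hℓ : Rat.HeightOneSpectrum.natGenerator v ≠ p) :
    PowerSeries.map (PadicInt.toZMod (p := p)) (eulerFactorElement W p v) =
      Polynomial.aeval
        (PowerSeries.C ((Rat.HeightOneSpectrum.natGenerator v : ZMod p))⁻¹ *
          PowerSeries.map (PadicInt.toZMod (p := p))
            (PowerSeries.binomialSeries ℤ_[p]
              (frobeniusExponent p (Rat.HeightOneSpectrum.natGenerator v : ℤ_[p]))))
        (eulerFactorModP W p v) := by
  obtain ⟨hcop, -⟩ := coprime_natGenerator v hℓ
  rw [eulerFactorElement_eq, Polynomial.aeval_def, Polynomial.hom_eval₂, eulerFactorModP,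
    Polynomial.aeval_def, Polynomial.eval₂_map]
  congr 1
  · exact RingHom.ext_int _ _
  · rw [map_mul, PowerSeries.map_C, toZMod_inv_natCast hcop]

/-- **Greenberg–Vatsal Prop. (2.4), the `λ`-invariant, IN THE KERNEL: `ord_T(𝒫_ℓ mod p) = s_ℓ · d_ℓ =
δ_E^{(ℓ)}`** (`= GreenbergVatsal2000.delta W p v`) at every prime `ℓ ≠ p`, `p` odd. Proof:
`𝒫_ℓ mod p = P̃_ℓ(ℓ̃⁻¹ + ε)` with `ε = ℓ̃⁻¹((1+T)^{f_ℓ} − 1) mod p` of `T`-order `p^{v_p(f_ℓ)} = s_ℓ`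
(§0–§1), and `ord_T P̃_ℓ(ℓ̃⁻¹ + ε) = mult_{ℓ̃⁻¹}(P̃_ℓ) · ord_T ε = d_ℓ · s_ℓ`. -/
theorem order_map_toZMod_eulerFactorElement (hp2 : p ≠ 2)
    (hℓ : Rat.HeightOneSpectrum.natGenerator v ≠ p) :
    (PowerSeries.map (PadicInt.toZMod (p := p)) (eulerFactorElement W p v)).order = delta W p v := by
  obtain ⟨hcop, h1⟩ := coprime_natGenerator v hℓ
  set ℓ := Rat.HeightOneSpectrum.natGenerator v with hℓdef
  set a : ZMod p := ((ℓ : ZMod p))⁻¹ with ha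
  set G := PowerSeries.map (PadicInt.toZMod (p := p))
    (PowerSeries.binomialSeries ℤ_[p] (frobeniusExponent p (ℓ : ℤ_[p]))) with hG
  have hsplit : PowerSeries.C a * G = PowerSeries.C a + PowerSeries.C a * (G - 1) := by ring
  have hG0 : PowerSeries.constantCoeff G = 1 := by
    rw [hG, ← PowerSeries.coeff_zero_eq_constantCoeff_apply, PowerSeries.coeff_map,
      PowerSeries.binomialSeries_coeff, Ring.choose_zero_right, one_smul, map_one]
  have hε0 : PowerSeries.constantCoeff (PowerSeries.C a * (G - 1)) = 0 := by
    rw [map_mul, map_sub, hG0, map_one, sub_self, mul_zero]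
  have hℓ0 : (ℓ : ZMod p) ≠ 0 := by
    rw [Ne, ZMod.natCast_eq_zero_iff]
    exact (Nat.Prime.coprime_iff_not_dvd hp.out).mp hcop
  have ha0 : a ≠ 0 := by
    rw [ha]
    exact inv_ne_zero hℓ0
  have hεord : (PowerSeries.C a * (G - 1)).order = sFactor p ℓ := by
    rw [PowerSeries.order_mul, PowerSeries.order_zero_of_unit
      ((PowerSeries.isUnit_iff_constantCoeff).mpr (by rwa [PowerSeries.constantCoeff_C, isUnit_iff_ne_zero])),
      zero_add, hG, order_map_binomialSeries_sub_one p (frobeniusExponent_natCast_ne_zero hcop h1),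
      ← pow_valuation_frobeniusExponent_eq_sFactor hp2 hcop h1, Nat.cast_pow]
  rw [map_toZMod_eulerFactorElement W v hℓ, ← hG, hsplit,
    order_aeval_C_add (eulerFactorModP_ne_zero W v) a hε0, hεord, delta_eq, dMultiplicity, ← ha,
    Nat.cast_mul, mul_comm]

/-- **`𝒫_ℓ(T)` is "a nonzero element of `Λ` which is not divisible by `p`"** (GV p. 9), i.e.
`μ(𝒫_ℓ) = 0` (Prop. (2.4): "Its `μ`-invariant is zero"): unit content, at every prime `ℓ ≠ p`,
`p` odd. -/
theorem hasUnitContent_eulerFactorElement (hp2 : p ≠ 2)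
    (hℓ : Rat.HeightOneSpectrum.natGenerator v ≠ p) : HasUnitContent (eulerFactorElement W p v) := by
  rw [hasUnitContent_iff_map_toZMod_ne_zero]
  intro h
  have := order_map_toZMod_eulerFactorElement W v hp2 hℓ
  rw [h, PowerSeries.order_zero] at this
  exact ENat.top_ne_coe _ this

/-- `𝒫_ℓ(T) ≠ 0` in `Λ` (`ℓ ≠ p`, `p` odd). -/
theorem eulerFactorElement_ne_zero (hp2 : p ≠ 2) (hℓ : Rat.HeightOneSpectrum.natGenerator v ≠ p) :
    eulerFactorElement W p v ≠ 0 := by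
  intro h
  have := (hasUnitContent_iff_map_toZMod_ne_zero _).mp (hasUnitContent_eulerFactorElement W v hp2 hℓ)
  exact this (by rw [h, map_zero])

end EulerFactor

/-! ## §3. Display (9): `μ^{anal}_{E,Σ₀} = μ^{anal}_E`, `λ^{anal}_{E,Σ₀} = λ^{anal}_E + Σ_{ℓ∈Σ₀} δ_E^{(ℓ)}` -/

section NonPrimitive

variable (W : WeierstrassCurve ℚ) {p : ℕ} [hp : Fact p.Prime] (S₀ : Finset (HeightOneSpectrum (𝓞 ℚ)))

/-- **`ord_T(∏_{ℓ∈Σ₀} 𝒫_ℓ mod p) = Σ_{ℓ∈Σ₀} δ_E^{(ℓ)}`** and the product has unit content, for a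
finite set `Σ₀` of places none of which lies above `p` (`p` odd). -/
theorem order_map_toZMod_eulerFactorProduct (hp2 : p ≠ 2)
    (hS : ∀ v ∈ S₀, Rat.HeightOneSpectrum.natGenerator v ≠ p) :
    HasUnitContent (eulerFactorProduct W p S₀) ∧
      (PowerSeries.map (PadicInt.toZMod (p := p)) (eulerFactorProduct W p S₀)).order =
        ((∑ v ∈ S₀, delta W p v : ℕ) : ℕ∞) := by
  induction S₀ using Finset.induction_on with
  | empty =>
    refine ⟨⟨0, ?_⟩, ?_⟩
    · rw [eulerFactorProduct_eq, Finset.prod_empty, PowerSeries.coeff_zero_eq_constantCoeff, map_one]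
      exact isUnit_one
    · rw [eulerFactorProduct_eq, Finset.prod_empty, map_one, PowerSeries.order_one, Finset.sum_empty,
        Nat.cast_zero]
  | insert v S hv ih =>
    obtain ⟨ihu, iho⟩ := ih (fun w hw => hS w (Finset.mem_insert_of_mem hw))
    have hvp := hS v (Finset.mem_insert_self v S)
    refine ⟨?_, ?_⟩
    · rw [eulerFactorProduct_eq, Finset.prod_insert hv, hasUnitContent_mul_iff, ← eulerFactorProduct_eq]
      exact ⟨hasUnitContent_eulerFactorElement W v hp2 hvp, ihu⟩
    · rw [eulerFactorProduct_eq, Finset.prod_insert hv, map_mul, PowerSeries.order_mul,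
        ← eulerFactorProduct_eq, iho, order_map_toZMod_eulerFactorElement W v hp2 hvp,
        Finset.sum_insert hv, Nat.cast_add]

/-- **`μ^{anal}_{E,Σ₀} = μ^{anal}_E`** (GV p. 9, "One clearly has"): for any `b ∈ Λ` (e.g. `ι b = ϖ·L`,
so that `ι(b · ∏𝒫_ℓ) = ϖ · L_{Σ₀}`, `iwasawaToPowerSeries_mul_eulerFactorProduct`), `b · ∏_{ℓ∈Σ₀} 𝒫_ℓ`
has unit content iff `b` has. -/
theorem hasUnitContent_mul_eulerFactorProduct_iff (hp2 : p ≠ 2)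
    (hS : ∀ v ∈ S₀, Rat.HeightOneSpectrum.natGenerator v ≠ p) (b : IwasawaAlgebra p) :
    HasUnitContent (b * eulerFactorProduct W p S₀) ↔ HasUnitContent b := by
  rw [hasUnitContent_mul_iff]
  exact ⟨fun h => h.1, fun h => ⟨h, (order_map_toZMod_eulerFactorProduct W S₀ hp2 hS).1⟩⟩

/-- **Display (9): `λ^{anal}_{E,Σ₀} = λ^{anal}_E + Σ_{ℓ∈Σ₀} δ_E^{(ℓ)}`** — for any `b ∈ Λ`,
`ord_T((b · ∏𝒫_ℓ) mod p) = ord_T(b mod p) + Σ_{ℓ∈Σ₀} δ_E^{(ℓ)}` (for `b` of unit content the left/right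
`T`-orders ARE the `λ`-invariants of `b^{Σ₀} = b·∏𝒫_ℓ` and `b`). -/
theorem order_map_toZMod_mul_eulerFactorProduct (hp2 : p ≠ 2)
    (hS : ∀ v ∈ S₀, Rat.HeightOneSpectrum.natGenerator v ≠ p) (b : IwasawaAlgebra p) :
    (PowerSeries.map (PadicInt.toZMod (p := p)) (b * eulerFactorProduct W p S₀)).order =
      (PowerSeries.map (PadicInt.toZMod (p := p)) b).order + ((∑ v ∈ S₀, delta W p v : ℕ) : ℕ∞) := by
  rw [map_mul, PowerSeries.order_mul, (order_map_toZMod_eulerFactorProduct W S₀ hp2 hS).2]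

/-- **Greenberg–Vatsal Thm. (1.5) (1)–(2), ANALYTIC HALF, as an exact transfer in `Λ`.** For any
`b, g ∈ Λ` (intended: `ι b = ϖ·L(E/ℚ,T)`, `g = f_E` or `T·f_E` a generator of `char X` times the
trivial-zero factor — the data of `lambda_muAnal_multiplicative_of_gvPar`) and `Σ₀ ∌ p` finite,
`p` odd: "`b` has unit content and `ord_T(b̄) = ord_T(ḡ)`" `⟺` "`b^{Σ₀} = b·∏_{ℓ∈Σ₀}𝒫_ℓ` has unit
content and `ord_T(b^{Σ₀} mod p) = ord_T(ḡ) + Σ_{ℓ∈Σ₀} δ_E^{(ℓ)}`". So the (iv)+(v) clause of the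
flag's named fact for THE primitive function is equivalent to the same clause for the NON-PRIMITIVE
function `L_{Σ₀}` — the object of GV Thm. (3.11) and (26)–(28) — with the printed shift (9). -/
theorem unitContent_and_order_eq_iff_nonPrimitive (hp2 : p ≠ 2)
    (hS : ∀ v ∈ S₀, Rat.HeightOneSpectrum.natGenerator v ≠ p) (b g : IwasawaAlgebra p) :
    (HasUnitContent b ∧
        (PowerSeries.map (PadicInt.toZMod (p := p)) b).order =
          (PowerSeries.map (PadicInt.toZMod (p := p)) g).order) ↔
      (HasUnitContent (b * eulerFactorProduct W p S₀) ∧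
        (PowerSeries.map (PadicInt.toZMod (p := p)) (b * eulerFactorProduct W p S₀)).order =
          (PowerSeries.map (PadicInt.toZMod (p := p)) g).order +
            ((∑ v ∈ S₀, delta W p v : ℕ) : ℕ∞)) := by
  rw [hasUnitContent_mul_eulerFactorProduct_iff W S₀ hp2 hS, order_map_toZMod_mul_eulerFactorProduct
    W S₀ hp2 hS]
  refine and_congr_right fun _ => ⟨fun h => by rw [h], fun h => ?_⟩
  exact WithTop.add_right_cancel (ENat.coe_ne_top _) h

end NonPrimitive

end Summit.BirchSwinnertonDyer.Rank1Residual.X2.EulerFactorInvariants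

end
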